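import Literature.NumberTheory.Automorphic.PicardCMEigenbasis
import Literature.AlgebraicGeometry.HodgeTheory.ComplexConjugationHolds
import Literature.AlgebraicGeometry.HodgeTheory.HodgeFiltrationModelsReductionProofs
import HarnessLib

/-!
# Records (iii) and (iii)♭ of the Picard–CM prerequisites are equivalent (tree-only leaf)

Family `hodge`, layer `Literature/NumberTheory/Automorphic`.  `PicardCMEigenbasis.lean` proves the kernel
bridge `PicardCM.cmAbelianVarietyRealised_of_eigenbasis hHD hI : (iii)♭ → (iii)` from the two model-free
Hodge-theory inputs `exists_isReal_hodgeModel` and `hodgePQ_independent_of_hodgeModel`, kept as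
hypotheses there so that its import cone stays light.  This leaf (which nothing imports) adds the converse
`(iii) → (iii)♭` under the same two inputs and then instantiates both inputs at the tree theorems
`exists_isReal_hodgeModel_holds` (`ComplexConjugationHolds.lean`) and
`hodgePQ_independent_of_hodgeModel_holds` (`HodgeFiltrationModelsReductionProofs.lean`):
unconditionally, `CMAbelianVarietyEigenbasisRealised ↔ CMAbelianVarietyRealised`.

What the `↔` means, and all it means: the re-typed record (iii)♭ (the verbatim eigenbasis form of
Shimura 1998, §5.2, pp. 38–39) is, over the tree theorems `exists_isReal_hodgeModel_holds` and
`hodgePQ_independent_of_hodgeModel_holds`, EQUIVALENT to record (iii); re-typing a hypothesis from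
(iii) to (iii)♭ is a citation re-typing (it changes which printed sentence the hypothesis quotes), not
a mathematical weakening or strengthening.  Both (iii) and (iii)♭ remain named records (`def … : Prop`,
unproved in the tree); neither is proved, cited away or discharged by this file, and nothing imports it.

* `PicardCM.cmAbelianVarietyEigenbasisRealised_of_realised` — `(hHD) (hI) : (iii) → (iii)♭`;
* `PicardCM.cmAbelianVarietyRealised_of_eigenbasis'` — `(iii)♭ → (iii)`;
* `PicardCM.cmAbelianVarietyEigenbasisRealised_iff` — `(iii)♭ ↔ (iii)`.
-/

open NumberField

namespace Literature.NumberTheory.Automorphic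

namespace PicardCM

open Literature.AlgebraicGeometry.Motives (SchemeOver ComplexPoints IsSmoothProjective CMType
  AbelianVariety)
open Literature.AlgebraicGeometry.HodgeTheory
open Literature.AlgebraicTopology.SingularHomology

/-- Record (iii) implies record (iii)♭ (so the two records are equivalent modulo degree-one Hodge
theory): choose a nonzero vector in each eigenline indexed by the CM type; these are linearly
independent (distinct characters) and of type `(1,0)`; a class of type `(1,0)` expands on the full
eigenbasis of `H¹`, and its component along the eigenlines outside the CM type is of type `(0,1)` and of
type `(1,0)` at once, hence zero (`H^{1,0} ⊓ H^{0,1} = 0`). Inputs as in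
`cmAbelianVarietyRealised_of_eigenbasis`.
[cite: Shimura1998, §3.2, pp. 19–20] [cite: VoisinHodgeI2002, §6.1.3 Cor. 6.12 and Cor. 6.14] -/
theorem cmAbelianVarietyEigenbasisRealised_of_realised (hHD : exists_isReal_hodgeModel)
    (hI : hodgePQ_independent_of_hodgeModel) (h : CMAbelianVarietyRealised) :
    CMAbelianVarietyEigenbasisRealised := by
  intro K _ _ _ Φ
  obtain ⟨A, ι, θ, hX, hfinV, hθ, hσ⟩ := h K Φ
  classical
  obtain ⟨M, -⟩ := hHD.exists_isHodgeSymmetric hX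
  have hmem : ∀ {p q} (v : complexBetti A.X 1),
      IsOfHodgeType (Module.finrank ℚ K / 2) A.X 1 p q v ↔ v ∈ modelPiece M 1 p q :=
    fun v ↦ isOfHodgeType_iff_mem_modelPiece M hI hX
  -- a nonzero vector in each eigenline
  have hex : ∀ τ : K →+* ℂ, ∃ v : complexBetti A.X 1, v ∈ eigenline θ τ ∧ v ≠ 0 := by
    intro τ
    obtain ⟨v, hv, -⟩ := finrank_eq_one_iff'.mp (hσ τ).1
    exact ⟨v, v.2, fun h0 ↦ hv (Subtype.ext h0)⟩
  choose w hw_mem hw_ne using hex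
  -- they form a basis of `H¹`
  have hind := iSupIndep_eigenline θ
  have hwli : LinearIndependent ℂ w := hind.linearIndependent _ hw_mem hw_ne
  haveI : Module.Finite ℂ (complexBetti A.X 1) := by
    apply Module.finite_of_finrank_pos
    rw [hfinV]; exact Module.finrank_pos
  have hwtop : Submodule.span ℂ (Set.range w) = ⊤ :=
    hwli.span_eq_top_of_card_eq_finrank' (by rw [Embeddings.card K ℂ, hfinV])
  refine ⟨A, ι, θ, hX, hθ, fun s ↦ w s.1, hwli.comp _ Subtype.val_injective,
    fun s ↦ ⟨hw_mem s.1, (hσ s.1).2.1 s.2 _ (hw_mem s.1)⟩, ?_⟩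
  intro v hv
  have hvtop : v ∈ Submodule.span ℂ (Set.range w) := by rw [hwtop]; exact Submodule.mem_top
  obtain ⟨c, hc⟩ := (Submodule.mem_span_range_iff_exists_fun ℂ).mp hvtop
  -- split the expansion of `v` along the CM type and its complement
  set v₁ := ∑ τ ∈ Finset.univ.filter (· ∈ Φ.1), c τ • w τ with hv₁
  set v₂ := ∑ τ ∈ Finset.univ.filter (· ∉ Φ.1), c τ • w τ with hv₂
  have hsplit : v = v₁ + v₂ := by
    rw [← hc, hv₁, hv₂, Finset.sum_filter_add_sum_filter_not]
  have hv₁mem : v₁ ∈ Submodule.span ℂ (Set.range fun s : Φ.1 ↦ w s.1) := by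
    refine Submodule.sum_mem _ fun τ hτ ↦ Submodule.smul_mem _ _ (Submodule.subset_span ?_)
    exact ⟨⟨τ, (Finset.mem_filter.mp hτ).2⟩, rfl⟩
  have hv₁10 : v₁ ∈ modelPiece M 1 1 0 := by
    refine Submodule.sum_mem _ fun τ hτ ↦ Submodule.smul_mem _ _ ?_
    exact (hmem _).mp ((hσ τ).2.1 (Finset.mem_filter.mp hτ).2 _ (hw_mem τ))
  have hv₂01 : v₂ ∈ modelPiece M 1 0 1 := by
    refine Submodule.sum_mem _ fun τ hτ ↦ Submodule.smul_mem _ _ ?_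
    exact (hmem _).mp ((hσ τ).2.2 (Finset.mem_filter.mp hτ).2 _ (hw_mem τ))
  have hv10 : v ∈ modelPiece M 1 1 0 := (hmem v).mp hv
  have hv₂10 : v₂ ∈ modelPiece M 1 1 0 := by
    have : v₂ = v - v₁ := by rw [hsplit]; abel
    rw [this]; exact Submodule.sub_mem _ hv10 hv₁10
  have hv₂0 : v₂ = 0 :=
    (Submodule.disjoint_def.mp (isCompl_modelPiece_one M).disjoint) v₂ hv₂10 hv₂01
  rw [hsplit, hv₂0, add_zero]; exact hv₁mem

/-- Record (iii)♭ implies record (iii), unconditionally: the bridge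
`cmAbelianVarietyRealised_of_eigenbasis` at the tree theorems `exists_isReal_hodgeModel_holds` and
`hodgePQ_independent_of_hodgeModel_holds`.
[cite: Shimura1998, §3.2, pp. 19–20] [cite: VoisinHodgeI2002, §6.1.3 Cor. 6.12 and Cor. 6.14] -/
theorem cmAbelianVarietyRealised_of_eigenbasis' (h : CMAbelianVarietyEigenbasisRealised) :
    CMAbelianVarietyRealised :=
  cmAbelianVarietyRealised_of_eigenbasis exists_isReal_hodgeModel_holds
    hodgePQ_independent_of_hodgeModel_holds h

/-- Records (iii)♭ and (iii) are equivalent, unconditionally.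
[cite: Shimura1998, §3.2, pp. 19–20] [cite: VoisinHodgeI2002, §6.1.3 Cor. 6.12 and Cor. 6.14] -/
theorem cmAbelianVarietyEigenbasisRealised_iff :
    CMAbelianVarietyEigenbasisRealised ↔ CMAbelianVarietyRealised :=
  ⟨cmAbelianVarietyRealised_of_eigenbasis', cmAbelianVarietyEigenbasisRealised_of_realised
    exists_isReal_hodgeModel_holds hodgePQ_independent_of_hodgeModel_holds⟩

end PicardCM

end Literature.NumberTheory.Automorphic
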